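import Summits.ResolutionOfSingularities.ResolutionOfSingularities.Theorems.FrobeniusLadderFInjectiveMacaulayficationKLocCellSound
import HarnessLib

/-!
# OFF-CELLS in the kernel-decidable kit: `checkKsOff` (target `h ^ m` instead of `1`) and its soundness `klocCellsOff_of_check`
# (crux `FInjectiveMacaulayfication` stmt-ResolutionOfSingularities-15315, chain w45a; E7 T₁₁/3 level 1 «over b minus V(P_c)»;
# res-L1-w45a-plan-1 R13.13 (1); owner res-D-pv-017 AS res-L1-w45a-stub-5)

Support file for crux stmt-ResolutionOfSingularities-15315 (`FrobeniusLadder.FInjectiveMacaulayfication`), chain w45a.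
[OURS · L1 W4.5a] — NOT a statement of any manuscript; AI-written, weaker than expert review.

The twin of `KLocCellKit.checkKs` / `KLocCellKit.klocCells_of_check` (res-D-pv-018, p518138 · p519543) for the OFF-CELLS of
`KLocCellOff`: an off-cell record `(S, R, T, T₀, H, m)` is a standard cell record plus an «avoid» polynomial `H` (term list) and an
exponent `m`, and certifies `h ^ m = Σ rr·expand p s_α + Σ_{i∈S} t_i Y_i + t₀ g` (`h = evalL K H`) instead of `1 = …`.
`cofactorNFKOff` = `cofactorNFK` (value `… − 1`) `+ 1 − h^m` in the kit's keyed normal form (`shiftK (−1,0,0) (powK (withKey H) m)`),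
`checkKsOff` = distinct residue keys of the ONE split of `g^(p−1)` and, per record, all coefficients of `cofactorNFKOff` divisible by
`p`; SOUNDNESS `klocCellOff_of_check` / `klocCellsOff_of_check` (the `KLocCellOff` off-cell binder VERBATIM for `g = evalL K G`,
`h = evalL K H`) and the consumer-shaped `offCells_of_check` (`∀ S ∈ SSoff, ∀ h ∈ HS.map (evalL K), <off-cell>` from a decidable
coverage of the pairs `(S, H)` by records). Definitions are computable list programs (no instances, no notation); no named facts.
[folklore]
-/

-- single-problem summit: the doubled namespace component is forced
set_option linter.dupNamespace false

noncomputable section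

namespace Summit.ResolutionOfSingularities.ResolutionOfSingularities.Theorems.FInjectiveMacaulayfication.KLocCellKit

open MvPolynomial
open Summit.ResolutionOfSingularities.ResolutionOfSingularities.Theorems.FInjectiveMacaulayfication

variable {n : ℕ}

/-! ## The list programs -/

/-- Normal form of `Σ_α r_α · expand p s_α + Σ_{i ∈ S} t_i · Y_i + t₀ · g − h ^ m`: the standard cofactor normal form
(value `… − 1`) plus `1` minus the normalised power `h ^ m` (`HK` keyed). [folklore] -/
def cofactorNFKOff (p : ℕ) (GK : List (ℤ × ℕ × (Fin n → ℕ))) (S : Finset (Fin n))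
    (gs : List (ℕ × (Fin n → ℕ) × List (ℤ × ℕ × (Fin n → ℕ)))) (R : List ((Fin n → ℕ) × List (ℤ × (Fin n → ℕ))))
    (T : Fin n → List (ℤ × (Fin n → ℕ))) (T₀ : List (ℤ × (Fin n → ℕ))) (HK : List (ℤ × ℕ × (Fin n → ℕ))) (m : ℕ) :
    List (ℤ × ℕ × (Fin n → ℕ)) :=
  addNFK (shiftK (((-1 : ℤ)), 0, (0 : Fin n → ℕ)) (powK HK m)) (addNFK [(1, 0, 0)] (cofactorNFK p GK S gs R T T₀))

/-- **The Boolean check of the OFF-CELLS of one chart** (one split of `g^(p-1)`, one `h^m`-cofactor identity per record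
`(S, R, T, T₀, H, m)`). [folklore] -/
def checkKsOff (p : ℕ) (G : List (ℤ × (Fin n → ℕ)))
    (cells : List (Finset (Fin n) × List ((Fin n → ℕ) × List (ℤ × (Fin n → ℕ))) × (Fin n → List (ℤ × (Fin n → ℕ))) ×
      List (ℤ × (Fin n → ℕ)) × List (ℤ × (Fin n → ℕ)) × ℕ)) : Bool :=
  let GK := withKey G
  let gs := splitK p (powK GK (p - 1))
  pwDistinct (gs.map fun g => g.1) &&
    cells.all fun c => (cofactorNFKOff p GK c.1 gs c.2.1 c.2.2.1 c.2.2.2.1 (withKey c.2.2.2.2.1) c.2.2.2.2.2).all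
      fun t => decide ((p : ℤ) ∣ t.1)

/-! ## Semantics and soundness -/

variable (K : Type) [Field K]

/-- Negation in the kit: `shiftK (−1, 0, 0)`. [folklore] -/
theorem evalK_shiftK_neg (L : List (ℤ × ℕ × (Fin n → ℕ))) :
    evalK K (shiftK (((-1 : ℤ)), 0, (0 : Fin n → ℕ)) L) = - evalK K L := by
  rw [evalK_shiftK]
  change (monomial (Finsupp.equivFunOnFinite.symm (0 : Fin n → ℕ)) (((-1 : ℤ) : ℤ) : K)) * evalK K L = _
  rw [Int.cast_neg, Int.cast_one, ← neg_one_mul (evalK K L)]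
  congr 1
  rw [show (monomial (Finsupp.equivFunOnFinite.symm (0 : Fin n → ℕ)) (-1 : K) : MvPolynomial (Fin n) K) =
    -(monomial (Finsupp.equivFunOnFinite.symm (0 : Fin n → ℕ)) (1 : K)) from by rw [← map_neg], monomial_symm_zero K]

/-- Soundness of the off-cofactor normal form: its value is `Σ r_α·expand p s_α + Σ_{i∈S} t_i Y_i + t₀ g − h ^ m`. [folklore] -/
theorem evalK_cofactorNFKOff (p : ℕ) (GK : List (ℤ × ℕ × (Fin n → ℕ))) (S : Finset (Fin n))
    (gs : List (ℕ × (Fin n → ℕ) × List (ℤ × ℕ × (Fin n → ℕ)))) (R : List ((Fin n → ℕ) × List (ℤ × (Fin n → ℕ))))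
    (T : Fin n → List (ℤ × (Fin n → ℕ))) (T₀ : List (ℤ × (Fin n → ℕ))) (HK : List (ℤ × ℕ × (Fin n → ℕ))) (m : ℕ) :
    evalK K (cofactorNFKOff p GK S gs R T T₀ HK m) =
      (List.zipWith (fun r e => r * expand p e.2) (gs.map fun g => evalK K (lookupRK R g.1 g.2.1))
          (gs.map fun g => ((Finsupp.equivFunOnFinite.symm g.2.1 : Fin n →₀ ℕ), evalK K g.2.2))).sum +
        ∑ i ∈ S, evalL K (T i) * X i + evalL K T₀ * evalK K GK - evalK K HK ^ m := by
  rw [cofactorNFKOff, evalK_addNFK, evalK_addNFK, evalK_shiftK_neg, evalK_powK, evalK_cofactorNFK, evalK_cons, evalK_nil]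
  simp only [Int.cast_one, add_zero]
  rw [monomial_symm_zero K]
  ring

/-- **ONE OFF-CELL FROM ONE KERNEL CHECK**: distinct residue keys of the computed split of `g^(p-1)` and the off-cofactor normal
form vanishing mod `p` give the `KLocCellOff` off-cell binder VERBATIM for `g = evalL K G`, `h = evalL K H` (witness `m`). [folklore] -/
theorem klocCellOff_of_check (p : ℕ) [Fact p.Prime] [CharP K p] (G : List (ℤ × (Fin n → ℕ))) (S : Finset (Fin n))
    (R : List ((Fin n → ℕ) × List (ℤ × (Fin n → ℕ)))) (T : Fin n → List (ℤ × (Fin n → ℕ))) (T₀ : List (ℤ × (Fin n → ℕ)))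
    (H : List (ℤ × (Fin n → ℕ))) (m : ℕ)
    (hkeys : pwDistinct ((splitK p (powK (withKey G) (p - 1))).map fun g => g.1) = true)
    (hcof : ∀ t ∈ cofactorNFKOff p (withKey G) S (splitK p (powK (withKey G) (p - 1))) R T T₀ (withKey H) m, (p : ℤ) ∣ t.1) :
    ∃ (L : List ((Fin n →₀ ℕ) × MvPolynomial (Fin n) K)) (rr : List (MvPolynomial (Fin n) K))
      (t : Fin n → MvPolynomial (Fin n) K) (t₀ : MvPolynomial (Fin n) K) (m : ℕ),
      (L.map Prod.fst).Nodup ∧ (∀ e ∈ L, ∀ i : Fin n, e.1 i < p) ∧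
      evalL K G ^ (p - 1) = (L.map fun e => MvPolynomial.monomial e.1 (1 : K) * MvPolynomial.expand p e.2).sum ∧
      evalL K H ^ m = (List.zipWith (fun r e => r * MvPolynomial.expand p e.2) rr L).sum +
        ∑ i ∈ S, t i * MvPolynomial.X i + t₀ * evalL K G := by
  have hp : 0 < p := (Fact.out : p.Prime).pos
  refine ⟨(splitK p (powK (withKey G) (p - 1))).map fun g => (Finsupp.equivFunOnFinite.symm g.2.1, evalK K g.2.2),
    (splitK p (powK (withKey G) (p - 1))).map fun g => evalK K (lookupRK R g.1 g.2.1), fun i => evalL K (T i), evalL K T₀, m,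
    splitK_nodup K p hp _ (pairwise_of_pwDistinct _ hkeys), ?_, ?_, ?_⟩
  · intro e he i
    obtain ⟨g, hg, rfl⟩ := List.mem_map.mp he
    simpa using (splitK_inv p hp _ g hg).2 i
  · rw [← evalK_withKey, ← evalK_powK, ← evalK_splitK K p]
  · have h := evalK_cofactorNFKOff K p (withKey G) S (splitK p (powK (withKey G) (p - 1))) R T T₀ (withKey H) m
    rw [evalK_eq_zero_of_dvd K p _ hcof, evalK_withKey, evalK_withKey] at h
    exact (sub_eq_zero.mp h.symm).symm

/-- **ALL OFF-CELLS OF ONE CHART FROM ONE KERNEL CHECK** (`checkKsOff`): for every record `r = (S, R, T, T₀, H, m)` the off-cell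
binder for the stratum `S` and `h = evalL K H`. [folklore] -/
theorem klocCellsOff_of_check (p : ℕ) [Fact p.Prime] [CharP K p] (G : List (ℤ × (Fin n → ℕ)))
    (cells : List (Finset (Fin n) × List ((Fin n → ℕ) × List (ℤ × (Fin n → ℕ))) × (Fin n → List (ℤ × (Fin n → ℕ))) ×
      List (ℤ × (Fin n → ℕ)) × List (ℤ × (Fin n → ℕ)) × ℕ))
    (hcheck : checkKsOff p G cells = true) :
    ∀ r ∈ cells, ∃ (L : List ((Fin n →₀ ℕ) × MvPolynomial (Fin n) K)) (rr : List (MvPolynomial (Fin n) K))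
      (t : Fin n → MvPolynomial (Fin n) K) (t₀ : MvPolynomial (Fin n) K) (m : ℕ),
      (L.map Prod.fst).Nodup ∧ (∀ e ∈ L, ∀ i : Fin n, e.1 i < p) ∧
      evalL K G ^ (p - 1) = (L.map fun e => MvPolynomial.monomial e.1 (1 : K) * MvPolynomial.expand p e.2).sum ∧
      evalL K r.2.2.2.2.1 ^ m = (List.zipWith (fun r e => r * MvPolynomial.expand p e.2) rr L).sum +
        ∑ i ∈ r.1, t i * MvPolynomial.X i + t₀ * evalL K G := by
  intro r hr
  simp only [checkKsOff, Bool.and_eq_true, List.all_eq_true, decide_eq_true_eq] at hcheck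
  obtain ⟨L, rr, t, t₀, m, h⟩ := klocCellOff_of_check K p G r.1 r.2.1 r.2.2.1 r.2.2.2.1 r.2.2.2.2.1 r.2.2.2.2.2 hcheck.1 (hcheck.2 r hr)
  exact ⟨L, rr, t, t₀, m, h⟩

/-- **THE CONSUMER SHAPE** (`KLocCellOff.honQuot_of_kLocCells_off`'s `hcellsOff` / `T11Char3Poly.hon3_of_cells_off`'s `hoff`):
from one `checkKsOff` and a decidable coverage of the pairs `(S, H) ∈ SSoff × HS` by records, the off-cells for every off stratum
and every avoid generator `h ∈ HS.map (evalL K)`. [folklore] -/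
theorem offCells_of_check (p : ℕ) [Fact p.Prime] [CharP K p] (G : List (ℤ × (Fin n → ℕ)))
    (SSoff : List (Finset (Fin n))) (HS : List (List (ℤ × (Fin n → ℕ))))
    (cells : List (Finset (Fin n) × List ((Fin n → ℕ) × List (ℤ × (Fin n → ℕ))) × (Fin n → List (ℤ × (Fin n → ℕ))) ×
      List (ℤ × (Fin n → ℕ)) × List (ℤ × (Fin n → ℕ)) × ℕ))
    (hcheck : checkKsOff p G cells = true)
    (hcover : ∀ S ∈ SSoff, ∀ H ∈ HS, ∃ r ∈ cells, r.1 = S ∧ r.2.2.2.2.1 = H) :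
    ∀ S ∈ SSoff, ∀ h ∈ HS.map (evalL K), ∃ (L : List ((Fin n →₀ ℕ) × MvPolynomial (Fin n) K)) (rr : List (MvPolynomial (Fin n) K))
      (t : Fin n → MvPolynomial (Fin n) K) (t₀ : MvPolynomial (Fin n) K) (m : ℕ),
      (L.map Prod.fst).Nodup ∧ (∀ e ∈ L, ∀ i : Fin n, e.1 i < p) ∧
      evalL K G ^ (p - 1) = (L.map fun e => MvPolynomial.monomial e.1 (1 : K) * MvPolynomial.expand p e.2).sum ∧
      h ^ m = (List.zipWith (fun r e => r * MvPolynomial.expand p e.2) rr L).sum +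
        ∑ i ∈ S, t i * MvPolynomial.X i + t₀ * evalL K G := by
  intro S hS h hh
  obtain ⟨H, hH, rfl⟩ := List.mem_map.mp hh
  obtain ⟨r, hr, rfl, rfl⟩ := hcover S hS H hH
  exact klocCellsOff_of_check K p G cells hcheck r hr

end Summit.ResolutionOfSingularities.ResolutionOfSingularities.Theorems.FInjectiveMacaulayfication.KLocCellKit

end
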